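import Literature.NumberTheory.EllipticCurves.ModularJacobianGaloisDataWithForms
import Literature.NumberTheory.EllipticCurves.ModularJacobianTwoTorsionSymmetricPairing
import HarnessLib

/-!
# ONE `ℚ`-structure of `J₀(N)` carrying BOTH the Galois compatibility of every lattice-compatible rational form AND the
# symmetric, Galois-invariant `w_N`-twisted Weil pairing on `J₀(N)[2]`: the JOINT carrier
# `ModularJacobianGaloisDataWithFormsAndPairing N ι` and its existence fact (Darmon–Diamond–Taylor 1995 §1.5, §1.6 Lemma 1.38,
# §1.7, Thm. 1.29, §4.4 (4.4.2); Shimura 1971 Thm. 7.9 / 7.14; Milne 1986 §16)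

Topic `Literature/NumberTheory/EllipticCurves`, next to `ModularJacobianGaloisDataWithForms.lean` (carrier
`ModularJacobianGaloisDataWithForms L ι` = `ModularJacobianGaloisData L ι` + the axiom `jacobiMapForm_galAct`: for every rational
lattice-compatible `g ∈ S₂(Γ₀(L))` the Jacobi map `jacobiMapForm D L g : J₀(L)(ℂ) → W(ℂ)` is `Γ_ℚ`-equivariant on torsion; existence
fact `nonempty_modularJacobianGaloisDataWithForms`) and `ModularJacobianTwoTorsionSymmetricPairing.lean` (carrier
`ModularJacobianGaloisDataWithPairing N ι` = `ModularJacobianGaloisData N ι` + the `w_N`-twisted Weil pairing `pairingTwo` on `J₀(N)[2]`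
with its five clauses; existence fact `exists_modularJacobianGaloisDataWithPairing_eichlerShimura`, which also carries the Eichler–Shimura
relation of `nonempty_modularJacobianGaloisData_eichlerShimura`).

WHY A JOINT CARRIER (D-0026 (iv), consumer named below). Both sibling structures are HYPOTHESIS structures over the same parent
`ModularJacobianGaloisData N ι` («the» action of `Γ_ℚ` on `J₀(N)(ℚ̄)_tors` transported along `ι`); neither claims uniqueness, and the
parent's axioms do NOT pin the true action (its docstring; review of p690607: a spurious `galAct` of order `15` on `J₀(23)[2]`). So the
two existence facts may be witnessed by DIFFERENT data, while a consumer that needs old-line equivariance (`jacobiMapForm_galAct`) AND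
invariance of the pairing (`pairingTwo_galAct`) needs them for the SAME `galAct`. Following the exact pattern by which
`ModularJacobianTwoTorsionSymmetricPairing.lean` merged the pairing with Eichler–Shimura («restated verbatim for the SAME datum, so that
a consumer needing both is fed ONE `D`»), THIS FILE declares

* the carrier `ModularJacobianGaloisDataWithFormsAndPairing N ι extends ModularJacobianGaloisDataWithForms N ι,
  ModularJacobianGaloisDataWithPairing N ι` — a DIAMOND on the common parent `ModularJacobianGaloisData N ι` (Lean merges the parent
  fields: ONE `galAct`, ONE `continuous_galAct`, …), with NO new fields;
* ONE named existence fact `exists_modularJacobianGaloisDataWithFormsAndPairing_eichlerShimura` (`def … : Prop`, CONVENTIONS §4):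
  for every `N ≥ 1` and `ι` there is such a joint datum whose `galAct` moreover satisfies the Eichler–Shimura relation, VERBATIM as in
  `exists_modularJacobianGaloisDataWithPairing_eichlerShimura` / `nonempty_modularJacobianGaloisData_eichlerShimura`;
* the PROJECTIONS onto the three existing facts (`…_of_withFormsAndPairing`), proved by forgetting structure.

Nothing else is asserted or proved. PROVENANCE of the fact = the conjunction of the provenances of the two sibling facts, which are
statements about ONE AND THE SAME object: THE `ℚ`-structure of `J₀(N)` (Shimura's canonical model of `X₀(N)` over `ℚ`, its Jacobian,
`J₀(N)(ℂ) = V/Λ` by Abel–Jacobi, torsion points algebraic, Hecke correspondences over `ℚ` — clauses (1)–(3) of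
`nonempty_algebraicModularParametrizationWithShift`), transported along `ι`, satisfies SIMULTANEOUSLY (4) `jacobiMapForm_galAct`
(`φ_g` is a `ℚ`-morphism `J₀(N) → W`: `q`-expansion principle [Darmon–Diamond–Taylor §1.5 p. 38, §1.7 Def. 1.44 / Lemma 1.46;
Shimura Thm. 7.14]), (i)–(iii) for `B(x, y) = ē₂(x, w_N y)` (perfect and `𝕋_ℤ`-balanced [op. cit. Lemma 1.38], symmetric [§4.4 (4.4.2),
proof of Cor. 4.19: «skew-symmetry of the pairings»; Milne §16, `−1 = 1` in `ℤ/2`], `Γ_ℚ`-invariant [Milne §16: `ē_m` is a pairing of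
Galois modules with values in `μ₂ ⊂ ℚ`; `w_N` is defined over `ℚ`]), and the Eichler–Shimura relation [op. cit. Thm. 1.29 p. 37 with
the proof of Thm. 3.1(a) p. 86; Shimura Thm. 7.9]. The three existing facts assert these properties of the true action separately
(forms / pairing + Eichler–Shimura / Eichler–Shimura); this one asserts them jointly. Not proved here (no `X₀(N)` over `ℚ` in the tree).

## Consumer and the precise clauses needed (D-0026 (iv))

Summit BirchSwinnertonDyer, crux C1 `MainConjectureTransportAlignedAtTwo` (stmt-BirchSwinnertonDyer-22296), residual (R2)
`stub_lamLawKilford`, route `AlignedTransportAtTwo`, UNEQUAL-conductor branch `N(W₂) = q·N(W₁)` (att-p4 g18, memo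
`Summits/BirchSwinnertonDyer/BirchSwinnertonDyer/Cruxes/MainConjectureTransportAlignedAtTwo/CARRIER-PROP-att-p4-g18.md` §3–§4, ASK 1):
the concrete cross-level capstone `…KilfordKernelLetterCrossLevelCarrier.uniformize_oldLine_ker_iff_of_carrier` consumes, for ONE
`J`, (a) the OLD-LINE row T2(J) = `J.jacobiMapForm_galAct W₁ N₁ D₁ F₁ _ hg` (equivariance of `D₁.jacobiMapForm N₂ F₁ hg` on
`J₀(N₂)_tors`) and (b) `J.pairingTwo` with `pairingTwo_galAct` (the (W1)/(W3) rows of the cell's kernel-letter carrier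
`Summit.BirchSwinnertonDyer.Rank1Residual.F1Sign2.KernelLetterCarrierAtTwo N ι J.toModularJacobianGaloisDataWithPairing`) — for the
SAME `galAct`; and (c) the Eichler–Shimura relation for that `galAct` (the `ρ̄ ⊕ ρ̄`-reading of `J[𝔪]`). Exactly these, nothing more.

## What is NOT here

No new axiom on either parent; no compatibility between `pairingTwo` and `jacobiMapForm` is asserted (none is printed or needed); no
uniqueness; no odd `ℓ`; the cell's (W1) multiplicative part is not in this file (it is the `Prop` `KernelLetterCarrierAtTwo` /
`KernelLetterCarrierWithFormsAtTwo` of `Summits/BirchSwinnertonDyer/Rank1Residual/F1Sign2/KernelLetterCarrierAtTwo.lean`).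

## References

* H. Darmon, F. Diamond, R. Taylor, *Fermat's Last Theorem*, CDM 1995: §1.3 Thm. 1.15 (p. 28), §1.5 (pp. 34–38), §1.6 Lemma 1.38
  (p. 41), §1.7 Def. 1.44 / Lemma 1.46 (pp. 44–45), Thm. 1.29 (p. 37) with the proof of Thm. 3.1(a) (p. 86), §4.4 (4.4.2) and proof of
  Cor. 4.19 (p. 127) (held text `paper:doi-10-4310-cdm-1995-v1995-n1-a1`). [DarmonDiamondTaylor1995]
* G. Shimura, *Introduction to the Arithmetic Theory of Automorphic Functions* (1971), §6.7, Prop. 7.7, Thm. 7.9, Thm. 7.14. [ShimuraIATAF1971]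
* J. S. Milne, *Abelian Varieties*, in: Arithmetic Geometry (Storrs 1984), Springer 1986, §16 (pairings `ē_m`, `ē^λ_m`, Lemma 16.2).
  [Milne1986AbelianVarieties]
* J. H. Silverman, *The Arithmetic of Elliptic Curves*, 2nd ed. 2009, II.4.2(c), III.5. [SilvermanAEC2009]

## Design notes

Namespace `Literature.NumberTheory.EllipticCurves.ModularForms` (as both siblings). The `extends A, B` diamond is resolved by Lean on
the shared parent `toModularJacobianGaloisData` (the generated `toModularJacobianGaloisDataWithPairing` re-assembles the parent, so
`D.toModularJacobianGaloisDataWithPairing.galAct = D.galAct` definitionally — checked by `rfl` in the typer's scratch and used silently by the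
projection theorems). The existence
fact is `∃ D, …` (NOT `∀ D`) for the reason recorded in both siblings (a clause «for every datum» would be FALSE). Typer filing
(-ty g15, cell `bsd-f1-sign2`, 2026-08-29) on att-p4 g18's ASK 1; net debt +1 (one named fact, three projections proved).
-/

noncomputable section

open scoped MatrixGroups ModularForm

open CongruenceSubgroup

namespace Literature.NumberTheory.EllipticCurves.ModularForms

/-- **`ℚ`-structure of `J₀(N)` WITH forms-equivariance AND the `w_N`-twisted Weil pairing on `J₀(N)[2]`** (joint carrier; hypothesis
structure; DIAMOND `extends` on the common parent `ModularJacobianGaloisData N ι`, no new fields): ONE `galAct` for which (4) every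
lattice-compatible rational form's Jacobi map `jacobiMapForm D N g` is `Γ_ℚ`-equivariant on torsion (`jacobiMapForm_galAct`, from
`ModularJacobianGaloisDataWithForms`) and (i)–(iii) `pairingTwo` is `𝕋_ℤ`-balanced, perfect, symmetric and `galAct`-invariant (from
`ModularJacobianGaloisDataWithPairing`). Existence (for the TRUE Galois action): `exists_modularJacobianGaloisDataWithFormsAndPairing_eichlerShimura`.
No uniqueness is claimed. [cite: DarmonDiamondTaylor1995, §1.5 (p. 34–38), §1.6 Lemma 1.38 (p. 41), §1.7 Def. 1.44 and Lemma 1.46 (p. 44–45), §4.4 (4.4.2)]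
[cite: ShimuraIATAF1971, Thm. 7.14] [cite: Milne1986AbelianVarieties, §16, Lemma 16.2 (a), (e)] -/
structure ModularJacobianGaloisDataWithFormsAndPairing (N : ℕ) [NeZero N] (ι : AlgebraicClosure ℚ →+* ℂ)
    extends ModularJacobianGaloisDataWithForms N ι, ModularJacobianGaloisDataWithPairing N ι

open GaloisRepresentations IsDedekindDomain Rat.HeightOneSpectrum NumberField in
/-- **Existence of the JOINT `ℚ`-structure of `J₀(N)`: forms-equivariance, the symmetric Galois-invariant `w_N`-twisted Weil pairing on
`J₀(N)[2]`, AND the Eichler–Shimura relation, for ONE datum** (named fact, statement only). For every `N ≥ 1` and `ι : ℚ̄ → ℂ` there is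
`D : ModularJacobianGaloisDataWithFormsAndPairing N ι` whose Galois action moreover satisfies, VERBATIM as in
`exists_modularJacobianGaloisDataWithPairing_eichlerShimura` and `nonempty_modularJacobianGaloisData_eichlerShimura` (Darmon–Diamond–Taylor
Thm. 1.29 p. 37 with the proof of Thm. 3.1(a) p. 86; Shimura Thm. 7.9): for every prime `p ∤ N`, every `𝔓 ∣ p` of `\bar ℤ`, every
arithmetic Frobenius `φ` at `𝔓` and every torsion point `x` killed by some `m` with `p ∤ m`, `φ(φ x) − T_p (φ x) + p x = 0`.
Provenance: THE action of `Γ_ℚ` on `J₀(N)(ℚ̄)_tors` transported along `ι` satisfies (4) [op. cit. §1.5 p. 38, §1.7; Shimura Thm. 7.14: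
`φ_g` is a `ℚ`-morphism by the `q`-expansion principle], (i)–(iii) [op. cit. Lemma 1.38, §4.4 (4.4.2); Milne §16] and Eichler–Shimura
[op. cit. Thm. 1.29] SIMULTANEOUSLY — the sibling facts `nonempty_modularJacobianGaloisDataWithForms`,
`exists_modularJacobianGaloisDataWithPairing_eichlerShimura`, `nonempty_modularJacobianGaloisData_eichlerShimura` assert them separately,
this one jointly (so that ONE datum feeds BSD C1 `stmt-BirchSwinnertonDyer-22296` (R2) at UNEQUAL conductors: old-line equivariance T2(J)
and `pairingTwo_galAct` for the same `galAct`, att-p4 g18 CARRIER-PROP memo §4 ASK 1). Not proved here (no `X₀(N)` over `ℚ` in the tree).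
[cite: DarmonDiamondTaylor1995, Thm. 1.29 (p. 37) with the proof of Thm. 3.1(a) (p. 86); §1.5 (p. 38); §1.6 Lemma 1.38 (p. 41); §1.7 Def. 1.44, Lemma 1.46 (p. 44–45); §4.4 (4.4.2) and proof of Cor. 4.19 (p. 127)]
[cite: ShimuraIATAF1971, Thm. 7.9, Thm. 7.14] [cite: Milne1986AbelianVarieties, §16: ē_m, ē^λ_m, Lemma 16.2 (a), (e)] -/
def exists_modularJacobianGaloisDataWithFormsAndPairing_eichlerShimura : Prop :=
  ∀ (N : ℕ) [NeZero N] (ι : AlgebraicClosure ℚ →+* ℂ), ∃ D : ModularJacobianGaloisDataWithFormsAndPairing N ι,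
    ∀ v : HeightOneSpectrum (𝓞 ℚ), ¬ ((primesEquiv v : Nat.Primes) : ℕ) ∣ N →
    ∀ 𝔓 ∈ v.primesAbove, ∀ φ : Field.absoluteGaloisGroup ℚ, IsArithFrobAt (𝓞 ℚ) φ 𝔓 →
    ∀ m : ℕ, ¬ ((primesEquiv v : Nat.Primes) : ℕ) ∣ m →
    ∀ x : J0.tors N, (m : HeckeRing0 N 2) • x = 0 →
      D.galAct φ (D.galAct φ x)
        - (HeckeRing0.T N 2 ((primesEquiv v : Nat.Primes) : ℕ) (primesEquiv v : Nat.Primes).2)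
            • D.galAct φ x
        + (((primesEquiv v : Nat.Primes) : ℕ) : HeckeRing0 N 2) • x = 0

/-- **Projection 1**: the joint fact implies `exists_modularJacobianGaloisDataWithPairing_eichlerShimura` — forget the forms axiom.
[cite: DarmonDiamondTaylor1995, §1.6 Lemma 1.38 (p. 41), Thm. 1.29 (p. 37)] -/
theorem exists_modularJacobianGaloisDataWithPairing_eichlerShimura_of_withFormsAndPairing
    (h : exists_modularJacobianGaloisDataWithFormsAndPairing_eichlerShimura) :
    exists_modularJacobianGaloisDataWithPairing_eichlerShimura := by
  intro N _ ι
  obtain ⟨D, hD⟩ := h N ι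
  exact ⟨D.toModularJacobianGaloisDataWithPairing, hD⟩

/-- **Projection 2**: the joint fact implies `nonempty_modularJacobianGaloisDataWithForms` — forget the pairing and Eichler–Shimura.
[cite: DarmonDiamondTaylor1995, §1.5 (p. 34–38), §1.7 Def. 1.44 and Lemma 1.46 (p. 44–45)] -/
theorem nonempty_modularJacobianGaloisDataWithForms_of_withFormsAndPairing
    (h : exists_modularJacobianGaloisDataWithFormsAndPairing_eichlerShimura) :
    nonempty_modularJacobianGaloisDataWithForms := by
  intro L _ ι
  obtain ⟨D, _⟩ := h L ι
  exact ⟨D.toModularJacobianGaloisDataWithForms⟩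

/-- **Projection 3**: the joint fact implies `nonempty_modularJacobianGaloisData_eichlerShimura` (Darmon–Diamond–Taylor Thm. 1.29 in
Galois form) — forget forms and pairing. [cite: DarmonDiamondTaylor1995, Thm. 1.29 (p. 37) with the proof of Thm. 3.1(a) (p. 86)] -/
theorem nonempty_modularJacobianGaloisData_eichlerShimura_of_withFormsAndPairing
    (h : exists_modularJacobianGaloisDataWithFormsAndPairing_eichlerShimura) :
    nonempty_modularJacobianGaloisData_eichlerShimura :=
  nonempty_modularJacobianGaloisData_eichlerShimura_of_withPairing
    (exists_modularJacobianGaloisDataWithPairing_eichlerShimura_of_withFormsAndPairing h)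

end Literature.NumberTheory.EllipticCurves.ModularForms

end
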